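import Mathlib
import HarnessLib

/-!
# Iterated sums of polynomials over integer ranges with polynomial bounds are polynomial
# (discrete Fubini on a chamber; the induction step of Ehrhart theory for interval-nested parametric polytopes)

## Sources

[St] R. P. Stanley, *Enumerative Combinatorics, Vol. 1*, 2nd ed. (CUP 2012; held `book:stanleynd-enumerative-combinatorics-volume-1`):
§4.4 "Quasipolynomials" (definition; Proposition 4.4.1: quasipolynomial ⇔ rational generating function with root-of-unity poles);
§4.6.2 Theorem 4.6.8 (Ehrhart: for a rational polytope `𝒫`, `n ↦ i(𝒫, n) = #(n𝒫 ∩ ℤ^m)` is a quasipolynomial of degree `dim 𝒫`,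
a polynomial when `𝒫` is integral); Chapter 4, Exercise 38 [3] (a linear system `Φ α = β` whose entries are integer polynomials in a
parameter `n` has a number of solutions `α ∈ ℕ^m` that is a quasipolynomial in `n` for `n` large — Chen–Li–Sam).
[KP] M. Kauers, P. Paule, *The Concrete Tetrahedron* (Springer 2011), Sect. 3.3: partial sums of a polynomial sequence of degree `d` form
a polynomial sequence of degree `d + 1` (in this tree: `Literature.Combinatorics.Enumerative.PolynomialSequenceGeneratingFunction`,
`isPolySeqOfDegree_partialSum`, one variable, field of characteristic zero).
Faulhaber–Bernoulli: `Σ_{k<n} k^p = (1/(p+1)) Σ_{i≤p} B_i C(p+1, i) n^{p+1−i}` is Mathlib's `sum_range_pow` (also M. Beck, S. Robins,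
*Computing the Continuous Discretely* (Springer 2007), Lemma 2.3 and the pyramid count (2.10) — held `book:beck2007-computing-continuous-discretely`,
not yet in `references.bib`).

## What is formalised (everything proved; no named facts)

The elementary engine behind [St, Ex. 4.38] in the INTERVAL-NESTED case, in several variables and RELATIVE TO A DOMAIN ("chamber")
`D ⊆ ℤ^d` — the form in which lattice-point counts of one-parameter families of polytopes are actually computed by peeling one coordinate
at a time (Beck–Robins (2.10): "once we pick the integer `m_d`, we have `t − m_d + 1` independent choices …"):

* `IsPolyOn D f` — `f : ℤ^d → ℚ` agrees on `D` with a polynomial `P ∈ ℚ[x_1, …, x_d]` (`MvPolynomial (Fin d) ℚ`); closure under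
  restriction, pointwise agreement, constants, coordinates, `+ − × ^`, finite `Σ`/`Π`, univariate polynomials of a polynomial function
  (`peval`), and SUBSTITUTION of polynomial integer-valued maps `σ : ℤ^d → ℤ^e` carrying `D` into the domain of the outer function (`comp`,
  via `MvPolynomial.bind₁`).
* `faulhaber p ∈ ℚ[X]` with `eval_faulhaber : F_p(n) = Σ_{k<n} k^p` (from `sum_range_pow`; the `ℝ[X]` twin is
  `Literature.NumberTheory.LFunctions.GORZAsymp.faulhaber` — same formula, cited not imported).
* ★ `IsPolyOn.sum_range` — if `len : ℤ^d → ℤ` is polynomial and `≥ 0` on `D` and `g(x, j)` is polynomial on the slab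
  `{(j, x) : x ∈ D, 0 ≤ j < len x} ⊆ ℤ^{d+1}`, then `x ↦ Σ_{0 ≤ j < len x} g(x, j)` is polynomial on `D`
  (expand `g(x, j) = Σ_p c_p(x) j^p` along the new variable with `MvPolynomial.finSuccEquiv`, sum with Faulhaber:
  `Σ_p c_p(x) F_p(len x)`); `IsPolyOn.sum_range_shift` — the same over `[lo x, lo x + len x)` with a polynomial lower bound.
* `IsPolyOn.exists_polynomial_nat` — on the parameter ray `{n ≥ 0} ⊆ ℤ¹` this is an honest `Polynomial ℚ` in `n`
  (so `…PolynomialSequenceGeneratingFunction.kp_thm_3_1_le` turns it into a rational generating function with its only pole at `1`).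
* Worked examples: the triangle `Σ_{a<n} Σ_{b<a} 1` and the Beck–Robins pyramid count `Σ_{m ≤ t} (t − m + 1)²` are polynomial on `t ≥ 0`.

Iterating `sum_range_shift` peels an interval-nested system `lo_i(x, m_1..m_{i−1}) ≤ m_i < lo_i + len_i` (all bounds polynomial — in
practice affine — in the outer variables and the parameters) down to a polynomial in the parameters on the chamber where every `len_i ≥ 0`:
the counting lemma asked for by FINDING-HEX-WALL-SLACK-FOUR-LAW §4b (5) of the pub-sawmu lane (diagonal polynomiality of the hexagonal
surface-renewal table), where Mathlib has no Ehrhart theory. Not covered: degrees (the sum raises the total degree by `deg len`),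
quasipolynomials / periods, general (non-nested) polytopes, reciprocity.
-/

namespace Literature.Combinatorics.Enumerative.PolynomialRangeSums

open Finset

variable {d : ℕ}

/-- `f : ℤ^d → ℚ` agrees ON `D ⊆ ℤ^d` with (the evaluation at integer points of) a polynomial in `d` variables with rational
coefficients — "`f` is a polynomial on the chamber `D`". OURS (notation). [cite: Stanley2012EC1, §4.4 (quasipolynomials), §4.6.2] -/
def IsPolyOn (D : Set (Fin d → ℤ)) (f : (Fin d → ℤ) → ℚ) : Prop :=
  ∃ P : MvPolynomial (Fin d) ℚ, ∀ x ∈ D, f x = MvPolynomial.eval (fun i => (x i : ℚ)) P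

namespace IsPolyOn

variable {D E : Set (Fin d → ℤ)} {f g : (Fin d → ℤ) → ℚ}

/-- Restriction to a smaller chamber (plumbing). [cite: Stanley2012EC1, §4.4] -/
theorem mono (h : IsPolyOn D f) (hE : E ⊆ D) : IsPolyOn E f := by
  obtain ⟨P, hP⟩ := h
  exact ⟨P, fun x hx => hP x (hE hx)⟩

/-- Functions agreeing on `D` are interchangeable (plumbing). [cite: Stanley2012EC1, §4.4] -/
theorem congr (h : IsPolyOn D f) (hfg : ∀ x ∈ D, f x = g x) : IsPolyOn D g := by
  obtain ⟨P, hP⟩ := h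
  exact ⟨P, fun x hx => (hfg x hx).symm.trans (hP x hx)⟩

/-- Constants are polynomial (plumbing). [cite: Stanley2012EC1, §4.4] -/
theorem const (c : ℚ) : IsPolyOn D fun _ => c :=
  ⟨MvPolynomial.C c, fun x _ => by simp⟩

/-- Coordinates are polynomial (plumbing). [cite: Stanley2012EC1, §4.4] -/
theorem coord (i : Fin d) : IsPolyOn D fun x => (x i : ℚ) :=
  ⟨MvPolynomial.X i, fun x _ => by simp⟩

/-- Sums of polynomial functions (plumbing). [cite: Stanley2012EC1, §4.4] -/
theorem add (hf : IsPolyOn D f) (hg : IsPolyOn D g) : IsPolyOn D fun x => f x + g x := by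
  obtain ⟨P, hP⟩ := hf
  obtain ⟨Q, hQ⟩ := hg
  exact ⟨P + Q, fun x hx => by dsimp only; rw [map_add, hP x hx, hQ x hx]⟩

/-- Negatives of polynomial functions (plumbing). [cite: Stanley2012EC1, §4.4] -/
theorem neg (hf : IsPolyOn D f) : IsPolyOn D fun x => -f x := by
  obtain ⟨P, hP⟩ := hf
  exact ⟨-P, fun x hx => by dsimp only; rw [map_neg, hP x hx]⟩

/-- Differences of polynomial functions (plumbing). [cite: Stanley2012EC1, §4.4] -/
theorem sub (hf : IsPolyOn D f) (hg : IsPolyOn D g) : IsPolyOn D fun x => f x - g x := by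
  obtain ⟨P, hP⟩ := hf
  obtain ⟨Q, hQ⟩ := hg
  exact ⟨P - Q, fun x hx => by dsimp only; rw [map_sub, hP x hx, hQ x hx]⟩

/-- Products of polynomial functions (plumbing). [cite: Stanley2012EC1, §4.4] -/
theorem mul (hf : IsPolyOn D f) (hg : IsPolyOn D g) : IsPolyOn D fun x => f x * g x := by
  obtain ⟨P, hP⟩ := hf
  obtain ⟨Q, hQ⟩ := hg
  exact ⟨P * Q, fun x hx => by dsimp only; rw [map_mul, hP x hx, hQ x hx]⟩

/-- Powers of polynomial functions (plumbing). [cite: Stanley2012EC1, §4.4] -/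
theorem pow (hf : IsPolyOn D f) (n : ℕ) : IsPolyOn D fun x => f x ^ n := by
  obtain ⟨P, hP⟩ := hf
  exact ⟨P ^ n, fun x hx => by dsimp only; rw [map_pow, hP x hx]⟩

/-- Finite sums of polynomial functions (plumbing). [cite: Stanley2012EC1, §4.4] -/
theorem sum {ι : Type*} (s : Finset ι) (F : ι → (Fin d → ℤ) → ℚ) (h : ∀ i ∈ s, IsPolyOn D (F i)) :
    IsPolyOn D fun x => ∑ i ∈ s, F i x := by
  classical
  induction s using Finset.induction_on with
  | empty => simpa using const (D := D) 0
  | insert a s ha ih =>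
    have h1 := (h a (mem_insert_self a s)).add (ih fun i hi => h i (mem_insert_of_mem hi))
    refine h1.congr fun x _ => ?_
    rw [sum_insert ha]

/-- Finite products of polynomial functions (plumbing). [cite: Stanley2012EC1, §4.4] -/
theorem prod {ι : Type*} (s : Finset ι) (F : ι → (Fin d → ℤ) → ℚ) (h : ∀ i ∈ s, IsPolyOn D (F i)) :
    IsPolyOn D fun x => ∏ i ∈ s, F i x := by
  classical
  induction s using Finset.induction_on with
  | empty => simpa using const (D := D) 1
  | insert a s ha ih =>
    have h1 := (h a (mem_insert_self a s)).mul (ih fun i hi => h i (mem_insert_of_mem hi))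
    refine h1.congr fun x _ => ?_
    rw [prod_insert ha]

/-- A univariate polynomial of a polynomial function is polynomial (plumbing). [cite: Stanley2012EC1, §4.4] -/
theorem peval (S : Polynomial ℚ) (hf : IsPolyOn D f) : IsPolyOn D fun x => S.eval (f x) := by
  have h := sum (range (S.natDegree + 1)) (fun i x => S.coeff i * f x ^ i)
    fun i _ => (const _).mul (hf.pow i)
  exact h.congr fun x _ => (Polynomial.eval_eq_sum_range (p := S) (f x)).symm

/-- `eval` of a substituted polynomial (plumbing). [folklore] -/
private theorem eval_bind₁_prs {e : ℕ} (v : Fin d → ℚ) (Q : Fin e → MvPolynomial (Fin d) ℚ)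
    (P : MvPolynomial (Fin e) ℚ) :
    MvPolynomial.eval v (MvPolynomial.bind₁ Q P) = MvPolynomial.eval (fun j => MvPolynomial.eval v (Q j)) P :=
  MvPolynomial.eval₂Hom_bind₁ _ _ _ _

/-- Substitution of polynomial (integer-valued) maps: if `g` is polynomial on `E ⊆ ℤ^e` and `σ : ℤ^d → ℤ^e` has
polynomial coordinates on `D` and maps `D` into `E`, then `g ∘ σ` is polynomial on `D` (substitution, `MvPolynomial.bind₁`).
[cite: Stanley2012EC1, §4.4; Chapter 4, Exercise 38] -/
theorem comp {e : ℕ} {E : Set (Fin e → ℤ)} {g : (Fin e → ℤ) → ℚ} (hg : IsPolyOn E g)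
    (σ : (Fin d → ℤ) → Fin e → ℤ) (hσ : ∀ j, IsPolyOn D fun x => (σ x j : ℚ))
    (hmaps : ∀ x ∈ D, σ x ∈ E) :
    IsPolyOn D fun x => g (σ x) := by
  obtain ⟨P, hP⟩ := hg
  choose Q hQ using hσ
  refine ⟨MvPolynomial.bind₁ Q P, fun x hx => ?_⟩
  dsimp only
  rw [hP _ (hmaps x hx), eval_bind₁_prs]
  congr 1
  exact congrArg _ (funext fun j => by have h := hQ j x hx; dsimp only at h; exact h)

end IsPolyOn

/-! ## Faulhaber: `Σ_{k<n} k^p` is a polynomial in `n` -/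

/-- Faulhaber's polynomial `F_p(X) = (1/(p+1)) Σ_{i ≤ p} B_i C(p+1, i) X^{p+1−i} ∈ ℚ[X]` (so that `F_p(n) = Σ_{k<n} k^p`,
Mathlib's `sum_range_pow`; Beck–Robins Lemma 2.3 writes it `(B_{p+1}(n) − B_{p+1})/(p+1)`). The `ℝ[X]` twin with the same
formula is `Literature.NumberTheory.LFunctions.GORZAsymp.faulhaber` (`faulhaber_eval`, `natDegree_faulhaber_le`); restated over `ℚ`
because `IsPolyOn` is rational-valued. [cite: KauersPaule2011, Sect. 3.3] -/
noncomputable def faulhaber (p : ℕ) : Polynomial ℚ :=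
  ∑ i ∈ range (p + 1), Polynomial.C (bernoulli i * ((p + 1).choose i : ℚ) / (p + 1)) * Polynomial.X ^ (p + 1 - i)

/-- `F_p(n) = Σ_{k<n} k^p` for every `n ∈ ℕ` (Mathlib's `sum_range_pow`, Faulhaber–Bernoulli). [cite: KauersPaule2011, Sect. 3.3] -/
theorem eval_faulhaber (p n : ℕ) : (faulhaber p).eval (n : ℚ) = ∑ k ∈ range n, (k : ℚ) ^ p := by
  rw [sum_range_pow, faulhaber, Polynomial.eval_finsetSum]
  refine sum_congr rfl fun i _ => ?_
  rw [Polynomial.eval_mul, Polynomial.eval_C, Polynomial.eval_pow, Polynomial.eval_X]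
  ring

/-! ## The summation lemma -/

/-- The integer point `(j, x) ∈ ℤ^{d+1}` (new coordinate first). [folklore] -/
private theorem cast_cons_prs (j : ℤ) (x : Fin d → ℤ) :
    (fun i => ((Fin.cons j x : Fin (d + 1) → ℤ) i : ℚ)) = Fin.cons (j : ℚ) (fun i => (x i : ℚ)) := by
  funext i
  refine Fin.cases ?_ (fun i => ?_) i
  · simp
  · simp

/-- ★ DISCRETE FUBINI ON A CHAMBER. Let `D ⊆ ℤ^d`, let `len : ℤ^d → ℤ` be polynomial and non-negative on `D`, and let
`g(x, j)` be polynomial on the slab `{(j, x) : x ∈ D, 0 ≤ j < len x}` (as a function on `ℤ^{d+1}`, new coordinate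
first). Then `x ↦ Σ_{0 ≤ j < len x} g(x, j)` is polynomial on `D`. (Write `g(x, j) = Σ_p c_p(x) j^p` from the given
polynomial; then the sum is `Σ_p c_p(x) F_p(len x)` with Faulhaber's `F_p`.) This is the induction step showing that the
number of lattice points of an interval-nested parametric polytope is a polynomial in the parameters on each chamber
(Stanley's Exercise 4.38 in the nested case; Beck–Robins (2.10) is the model computation).
[cite: Stanley2012EC1, §4.6.2, Theorem 4.6.8; Chapter 4, Exercise 38; KauersPaule2011, Sect. 3.3] -/
theorem IsPolyOn.sum_range {D : Set (Fin d → ℤ)} {len : (Fin d → ℤ) → ℤ} {g : (Fin d → ℤ) → ℤ → ℚ}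
    (hlen : IsPolyOn D fun x => (len x : ℚ)) (hlen0 : ∀ x ∈ D, 0 ≤ len x)
    (hg : IsPolyOn {y : Fin (d + 1) → ℤ | Fin.tail y ∈ D ∧ 0 ≤ y 0 ∧ y 0 < len (Fin.tail y)}
      fun y => g (Fin.tail y) (y 0)) :
    IsPolyOn D fun x => ∑ j ∈ range (len x).toNat, g x j := by
  obtain ⟨P, hP⟩ := hg
  -- the polynomial in the new variable, with coefficients polynomials in the old ones
  set Q : Polynomial (MvPolynomial (Fin d) ℚ) := MvPolynomial.finSuccEquiv ℚ d P with hQ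
  set N : ℕ := Q.natDegree + 1 with hN
  -- (1) on the slab, `g x j = Σ_{n<N} c_n(x) j^n`
  have hexp : ∀ x ∈ D, ∀ j : ℕ, (j : ℤ) < len x →
      g x j = ∑ n ∈ range N, MvPolynomial.eval (fun i => (x i : ℚ)) (Q.coeff n) * (j : ℚ) ^ n := by
    intro x hx j hj
    have hy : (Fin.cons (j : ℤ) x : Fin (d + 1) → ℤ) ∈
        {y : Fin (d + 1) → ℤ | Fin.tail y ∈ D ∧ 0 ≤ y 0 ∧ y 0 < len (Fin.tail y)} := by
      refine ⟨?_, ?_, ?_⟩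
      · simpa using hx
      · simp
      · simpa using hj
    have h1 := hP _ hy
    simp only [Fin.tail_cons, Fin.cons_zero] at h1
    rw [h1, cast_cons_prs, MvPolynomial.eval_eq_eval_mv_eval', Polynomial.eval_eq_sum_range'
      (lt_of_le_of_lt Polynomial.natDegree_map_le (Nat.lt_succ_self _))]
    refine sum_congr rfl fun n _ => ?_
    rw [Polynomial.coeff_map, Int.cast_natCast]
  -- (2) the candidate: `Σ_n c_n(x) · F_n(len x)`
  have hcand : IsPolyOn D fun x =>
      ∑ n ∈ range N, MvPolynomial.eval (fun i => (x i : ℚ)) (Q.coeff n) * (faulhaber n).eval (len x : ℚ) :=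
    IsPolyOn.sum _ _ fun n _ => IsPolyOn.mul ⟨Q.coeff n, fun x _ => rfl⟩ (hlen.peval (faulhaber n))
  refine hcand.congr fun x hx => ?_
  -- (3) the identity on `D`
  have hl : ((len x).toNat : ℚ) = (len x : ℚ) := by exact_mod_cast Int.toNat_of_nonneg (hlen0 x hx)
  symm
  calc ∑ j ∈ range (len x).toNat, g x j
      = ∑ j ∈ range (len x).toNat, ∑ n ∈ range N,
          MvPolynomial.eval (fun i => (x i : ℚ)) (Q.coeff n) * (j : ℚ) ^ n := by
        refine sum_congr rfl fun j hj => hexp x hx j ?_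
        have := mem_range.1 hj
        have h0 := hlen0 x hx
        omega
    _ = ∑ n ∈ range N, MvPolynomial.eval (fun i => (x i : ℚ)) (Q.coeff n) *
          ∑ j ∈ range (len x).toNat, (j : ℚ) ^ n := by
        rw [sum_comm]
        refine sum_congr rfl fun n _ => ?_
        rw [mul_sum]
    _ = ∑ n ∈ range N, MvPolynomial.eval (fun i => (x i : ℚ)) (Q.coeff n) * (faulhaber n).eval (len x : ℚ) := by
        refine sum_congr rfl fun n _ => ?_
        rw [← hl, eval_faulhaber]

/-- The same with a polynomial lower bound: `x ↦ Σ_{0 ≤ j < len x} g(x, lo x + j)`, i.e. the sum of `g(x, ·)` over the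
integer interval `[lo x, lo x + len x)`, is polynomial on `D` when `lo`, `len ≥ 0` are polynomial on `D` and `g` is
polynomial on the slab `{(i, x) : x ∈ D, lo x ≤ i < lo x + len x}`.
[cite: Stanley2012EC1, §4.6.2, Theorem 4.6.8; Chapter 4, Exercise 38; KauersPaule2011, Sect. 3.3] -/
theorem IsPolyOn.sum_range_shift {D : Set (Fin d → ℤ)} {lo len : (Fin d → ℤ) → ℤ} {g : (Fin d → ℤ) → ℤ → ℚ}
    (hlo : IsPolyOn D fun x => (lo x : ℚ)) (hlen : IsPolyOn D fun x => (len x : ℚ))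
    (hlen0 : ∀ x ∈ D, 0 ≤ len x)
    (hg : IsPolyOn {y : Fin (d + 1) → ℤ | Fin.tail y ∈ D ∧ lo (Fin.tail y) ≤ y 0 ∧ y 0 < lo (Fin.tail y) + len (Fin.tail y)}
      fun y => g (Fin.tail y) (y 0)) :
    IsPolyOn D fun x => ∑ j ∈ range (len x).toNat, g x (lo x + j) := by
  -- the slab over `D` in the shifted coordinate `j = i − lo x`
  set D' : Set (Fin (d + 1) → ℤ) := {y | Fin.tail y ∈ D ∧ 0 ≤ y 0 ∧ y 0 < len (Fin.tail y)} with hD'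
  -- `lo ∘ tail` is polynomial on the slab
  have hlo' : IsPolyOn D' fun y => (lo (Fin.tail y) : ℚ) :=
    hlo.comp (fun y => Fin.tail y) (fun i => IsPolyOn.coord i.succ) fun y hy => hy.1
  -- substitute `i = lo x + j`
  have hsub : IsPolyOn D' fun y => g (Fin.tail y) (lo (Fin.tail y) + y 0) := by
    have hc := hg.comp (D := D') (fun y => Fin.cons (lo (Fin.tail y) + y 0) (Fin.tail y)) ?_ ?_
    · refine hc.congr fun y _ => ?_
      simp only [Fin.tail_cons, Fin.cons_zero]
    · intro j
      refine Fin.cases ?_ (fun i => ?_) j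
      · simp only [Fin.cons_zero, Int.cast_add]
        exact hlo'.add (IsPolyOn.coord 0)
      · simp only [Fin.cons_succ]
        exact IsPolyOn.coord i.succ
    · rintro y ⟨hyD, hy0, hy1⟩
      refine ⟨?_, ?_, ?_⟩
      · simpa only [Fin.tail_cons] using hyD
      · simp only [Fin.cons_zero, Fin.tail_cons]; omega
      · simp only [Fin.cons_zero, Fin.tail_cons]; omega
  exact IsPolyOn.sum_range (g := fun x j => g x (lo x + j)) hlen hlen0 hsub

/-! ## One parameter: an honest polynomial in `n` on the ray `n ≥ 0` -/

/-- On the parameter ray `{n ≥ 0} ⊆ ℤ¹` a polynomial-on-the-chamber function is a univariate rational polynomial in `n` (so the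
vocabulary of `…PolynomialSequenceGeneratingFunction` — `IsPolySeqOfDegreeLE`, `kp_thm_3_1_le` — applies).
[cite: KauersPaule2011, Sect. 3.2; Stanley2012EC1, §4.4, Proposition 4.4.1] -/
theorem IsPolyOn.exists_polynomial_nat {f : ℤ → ℚ} (h : IsPolyOn {x : Fin 1 → ℤ | 0 ≤ x 0} fun x => f (x 0)) :
    ∃ P : Polynomial ℚ, ∀ n : ℕ, f n = P.eval (n : ℚ) := by
  obtain ⟨Q, hQ⟩ := h
  refine ⟨MvPolynomial.aeval (fun _ : Fin 1 => (Polynomial.X : Polynomial ℚ)) Q, fun n => ?_⟩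
  have h1 := hQ (fun _ => (n : ℤ)) (by simp)
  dsimp only at h1
  rw [h1, ← Polynomial.coe_aeval_eq_eval, ← AlgHom.comp_apply, MvPolynomial.comp_aeval]
  simp only [Polynomial.aeval_X, Int.cast_natCast]
  rw [← MvPolynomial.coe_aeval_eq_eval]
  rfl

/-! ## Worked examples -/

/-- The triangle: `n ↦ Σ_{a<n} Σ_{b<a} 1` (`= n(n−1)/2`) is polynomial on `n ≥ 0` — two applications of `sum_range`.
[cite: Stanley2012EC1, §4.6.2; KauersPaule2011, Sect. 3.3] -/
theorem isPolyOn_triangle :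
    IsPolyOn {x : Fin 1 → ℤ | 0 ≤ x 0} fun x => ∑ a ∈ range (x 0).toNat, ∑ _b ∈ range (a : ℤ).toNat, (1 : ℚ) := by
  refine IsPolyOn.sum_range (g := fun _ a => ∑ _b ∈ range a.toNat, (1 : ℚ)) (IsPolyOn.coord 0) (fun x hx => hx) ?_
  refine IsPolyOn.sum_range (g := fun _ _ => (1 : ℚ)) (IsPolyOn.coord 0) (fun y hy => hy.2.1) ?_
  exact IsPolyOn.const 1

/-- The Beck–Robins pyramid over the unit square (their (2.10) with `d = 3`): `t ↦ Σ_{0 ≤ m ≤ t} (t − m + 1)²`, the number of lattice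
points of the `t`-th dilate, is polynomial on `t ≥ 0` — one application of `sum_range` with the polynomial summand `(t − m + 1)²`.
[cite: Stanley2012EC1, §4.6.2, Theorem 4.6.8] -/
theorem isPolyOn_pyramid :
    IsPolyOn {x : Fin 1 → ℤ | 0 ≤ x 0} fun x => ∑ m ∈ range (x 0 + 1).toNat, ((x 0 : ℚ) - m + 1) ^ 2 := by
  refine IsPolyOn.sum_range (g := fun x m => ((x 0 : ℚ) - m + 1) ^ 2)
    (((IsPolyOn.coord 0).add (IsPolyOn.const 1)).congr fun x _ => by simp)
    (fun x hx => by have : 0 ≤ x 0 := hx; omega) ?_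
  refine IsPolyOn.pow (((?_ : IsPolyOn _ _).sub (IsPolyOn.coord 0)).add (IsPolyOn.const 1)) 2
  exact IsPolyOn.coord (1 : Fin 2)

end Literature.Combinatorics.Enumerative.PolynomialRangeSums
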